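import Summits.ResolutionOfSingularities.ResolutionOfSingularities.Theorems.FrobeniusLadderFRationalResolutionFixedPointLocal
import Mathlib.RingTheory.Spectrum.Prime.Topology
import HarnessLib

/-!
# Crux `FrobeniusLadder.FRationalResolution` (stmt-ResolutionOfSingularities-15317), line `redirect`,
# stub `stub_diagonalizableQuotientResolution` — neighbourhoods of a FIXED prime of the chart ring
# can be shrunk to INVARIANT (degree-zero) basic opens

Step (b) of the Kato (7.1)-at-fixed-points plan (memo MEMO-15317-leafhand2-g3 §6): the snc
neighbourhood `D(f) ∋ 𝔔` produced upstairs in `Spec S` (`…RsopStrataNhd.exists_nhd_of_isRsopPart`)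
must be replaced by a neighbourhood pulled back from the quotient `Spec S₀`, i.e. by `D(g)` with `g`
of DEGREE ZERO. At a fixed prime this is always possible: `Spec S → Spec S₀` is integral (closed) and
the fibre of `𝔮 = 𝔔 ∩ S₀` is the single point `𝔔` (`…FixedPointLocal.le_of_under_le_of_fixed`).

* `exists_gradeZero_mem_span_not_mem_of_fixed` — for `f ∉ 𝔔` there is `g ∈ S₀ ∩ (f)` with `g ∉ 𝔔`;
* **`exists_gradeZero_basicOpen_subset_of_fixed`** — hence a degree-zero `g ∉ 𝔔` with
  `D(g) ⊆ D(f)` in `Spec S` (every prime avoiding `g` avoids `f`);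
* `exists_gradeZero_basicOpen_subset_of_fixed'` — the same in `PrimeSpectrum.basicOpen` form.

Honest label: plumbing brick (no stub closed). No definitions, no named facts, no sorry.
[folklore; cite: Matsumura1987, Thm. 9.4]
-/

noncomputable section

-- single-problem summit: the doubled namespace component is forced
set_option linter.dupNamespace false

namespace Summit.ResolutionOfSingularities.ResolutionOfSingularities.Theorems.FRationalResolution.FixedPointSaturation

universe u v w

variable {R : Type u} {S : Type v} {A : Type w} [CommRing R] [CommRing S] [Algebra R S]
  [DecidableEq A] [AddCommGroup A] (𝒮 : A → Submodule R S) [GradedAlgebra 𝒮]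

/-- **Degree-zero multiples outside a fixed prime.** If `𝔔` is a fixed prime (`S_a ⊆ 𝔔` for all
`a ≠ 0`, torsion grading) and `f ∉ 𝔔`, then the ideal `(f)` contains a degree-`0` element
`g ∉ 𝔔` (otherwise `(f) ∩ S₀ ⊆ 𝔔 ∩ S₀` and `(f) ⊆ 𝔔` by `…FixedPointLocal.le_of_under_le_of_fixed`).
[folklore; cite: Matsumura1987, Thm. 9.4] -/
theorem exists_gradeZero_mem_span_not_mem_of_fixed (hA : AddMonoid.IsTorsion A) (𝔔 : Ideal S)
    [𝔔.IsPrime] (hfix : ∀ a : A, a ≠ 0 → ∀ s ∈ 𝒮 a, s ∈ 𝔔) (f : S) (hf : f ∉ 𝔔) :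
    ∃ g : 𝒮 0, (g : S) ∈ Ideal.span {f} ∧ (g : S) ∉ 𝔔 := by
  by_contra h
  push Not at h
  have hle : (Ideal.span {f}).comap (algebraMap (𝒮 0) S) ≤ 𝔔.comap (algebraMap (𝒮 0) S) := by
    intro g hg
    rw [Ideal.mem_comap] at hg ⊢
    exact h g hg
  have h𝔔 := FixedPointLocal.le_of_under_le_of_fixed 𝒮 hA 𝔔 hfix (Ideal.span {f}) hle
  exact hf (h𝔔 (Ideal.subset_span (Set.mem_singleton f)))

/-- **Invariant neighbourhoods of a fixed prime are cofinal**: for `f ∉ 𝔔` (`𝔔` fixed, torsion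
grading) there is a DEGREE-ZERO `g ∉ 𝔔` such that every prime of `S` avoiding `g` avoids `f`
(`D(g) ⊆ D(f)`). [folklore; cite: Matsumura1987, Thm. 9.4] -/
theorem exists_gradeZero_basicOpen_subset_of_fixed (hA : AddMonoid.IsTorsion A) (𝔔 : Ideal S)
    [𝔔.IsPrime] (hfix : ∀ a : A, a ≠ 0 → ∀ s ∈ 𝒮 a, s ∈ 𝔔) (f : S) (hf : f ∉ 𝔔) :
    ∃ g : 𝒮 0, (g : S) ∉ 𝔔 ∧ ∀ 𝔔' : Ideal S, 𝔔'.IsPrime → (g : S) ∉ 𝔔' → f ∉ 𝔔' := by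
  obtain ⟨g, hgf, hg⟩ := exists_gradeZero_mem_span_not_mem_of_fixed 𝒮 hA 𝔔 hfix f hf
  refine ⟨g, hg, fun 𝔔' _ hg' hf' => hg' ?_⟩
  exact (Ideal.span_singleton_le_iff_mem (I := 𝔔')).mpr hf' hgf

/-- The same in `Spec S`: a degree-zero basic open neighbourhood of `𝔔` inside `D(f)`.
[folklore; cite: Matsumura1987, Thm. 9.4] -/
theorem exists_gradeZero_basicOpen_subset_of_fixed' (hA : AddMonoid.IsTorsion A) (𝔔 : Ideal S)
    [𝔔.IsPrime] (hfix : ∀ a : A, a ≠ 0 → ∀ s ∈ 𝒮 a, s ∈ 𝔔) (f : S) (hf : f ∉ 𝔔) :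
    ∃ g : 𝒮 0, (g : S) ∉ 𝔔 ∧
      (PrimeSpectrum.basicOpen (g : S) : Set (PrimeSpectrum S)) ⊆ PrimeSpectrum.basicOpen f := by
  obtain ⟨g, hg, h⟩ := exists_gradeZero_basicOpen_subset_of_fixed 𝒮 hA 𝔔 hfix f hf
  refine ⟨g, hg, fun 𝔓 h𝔓 => ?_⟩
  rw [SetLike.mem_coe, PrimeSpectrum.mem_basicOpen] at h𝔓 ⊢
  exact h 𝔓.asIdeal 𝔓.isPrime h𝔓

end Summit.ResolutionOfSingularities.ResolutionOfSingularities.Theorems.FRationalResolution.FixedPointSaturation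

end
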